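import Summits.MatrixMultiplication.OmegaCensus.STPPVosperSlackTwoTablesZ53
import Summits.MatrixMultiplication.OmegaCensus.STPPVosperTilingWordsPrunedQ
import Summits.MatrixMultiplication.OmegaCensus.STPPVosperSlackTwoLawABQ

/-!
# ω-census (abelian STPP census): ℤ₅₃ leaf {(2,3,3)³} — dead-table rows for case A (`tblZ53A`) (kernel computations)

HONEST FRAMING (pub-omega census; verbatim): lottery ticket; floor = certified bounds/negative ranges.
Census STRUCTURE (seat pub-omega-stpp-2 gen 31, 2026-08-29), family (b2).  For each entry `e = (Yo, Zo)` of the dead table `tblZ53A` (`STPPVosperSlackTwoTablesZ53.lean`, 5 entries) the words-cover search over the two other blocks returns `false` (SWAPPED orientation, enumerator `blockDiffsWQ`, blocks (3,2,3),(3,2,3); ≤ 30k mirror steps each; soundness via `coverDead_forall_of_rows_swapped`).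
Each theorem is ONE `decide +kernel` over a range of table entries; the assembly `dead53A` is in the same file.  Nothing here is progress on `ω`.
-/

namespace Summit.MatrixMultiplication.OmegaCensus.CubeNB.S2

open Summit.MatrixMultiplication.OmegaCensus.CubeNB

/-- Dead-table entries `[0, 2)` of `tblZ53A`: the words-cover search fails. [folklore] -/
theorem dead53A_c0 : ∀ e ∈ (tblZ53A.drop 0).take 2, existsCoverW 53 e.2 e.1 [blockDiffsWQ 53 e.2 e.1 3 2 3, blockDiffsWQ 53 e.2 e.1 3 2 3] [] [] [] = false := by
  decide +kernel

/-- Dead-table entries `[2, 4)` of `tblZ53A`: the words-cover search fails. [folklore] -/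
theorem dead53A_c1 : ∀ e ∈ (tblZ53A.drop 2).take 2, existsCoverW 53 e.2 e.1 [blockDiffsWQ 53 e.2 e.1 3 2 3, blockDiffsWQ 53 e.2 e.1 3 2 3] [] [] [] = false := by
  decide +kernel

/-- Dead-table entries `[4, 5)` of `tblZ53A`: the words-cover search fails. [folklore] -/
theorem dead53A_c2 : ∀ e ∈ (tblZ53A.drop 4).take 1, existsCoverW 53 e.2 e.1 [blockDiffsWQ 53 e.2 e.1 3 2 3, blockDiffsWQ 53 e.2 e.1 3 2 3] [] [] [] = false := by
  decide +kernel

/-- **Dead table `tblZ53A`**: every entry's words-cover search fails. [folklore] -/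
theorem dead53A : ∀ e ∈ tblZ53A, existsCoverW 53 e.2 e.1 [blockDiffsWQ 53 e.2 e.1 3 2 3, blockDiffsWQ 53 e.2 e.1 3 2 3] [] [] [] = false := by
  have h5 : ∀ e ∈ tblZ53A.drop 5, existsCoverW 53 e.2 e.1 [blockDiffsWQ 53 e.2 e.1 3 2 3, blockDiffsWQ 53 e.2 e.1 3 2 3] [] [] [] = false := by
    intro e he
    rw [List.drop_of_length_le (by decide +kernel)] at he
    exact absurd he List.not_mem_nil
  have h4 : ∀ e ∈ tblZ53A.drop 4, existsCoverW 53 e.2 e.1 [blockDiffsWQ 53 e.2 e.1 3 2 3, blockDiffsWQ 53 e.2 e.1 3 2 3] [] [] [] = false :=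
    forall_drop_of_take_drop _ 4 1 dead53A_c2 (by rw [show 4 + 1 = 5 from rfl]; exact h5)
  have h2 : ∀ e ∈ tblZ53A.drop 2, existsCoverW 53 e.2 e.1 [blockDiffsWQ 53 e.2 e.1 3 2 3, blockDiffsWQ 53 e.2 e.1 3 2 3] [] [] [] = false :=
    forall_drop_of_take_drop _ 2 2 dead53A_c1 (by rw [show 2 + 2 = 4 from rfl]; exact h4)
  have h0 : ∀ e ∈ tblZ53A.drop 0, existsCoverW 53 e.2 e.1 [blockDiffsWQ 53 e.2 e.1 3 2 3, blockDiffsWQ 53 e.2 e.1 3 2 3] [] [] [] = false :=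
    forall_drop_of_take_drop _ 0 2 dead53A_c0 (by rw [show 0 + 2 = 2 from rfl]; exact h2)
  intro e he
  exact h0 e (by rwa [List.drop_zero])

end Summit.MatrixMultiplication.OmegaCensus.CubeNB.S2
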